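import Summits.ResolutionOfSingularities.ResolutionOfSingularities.Theorems.FrobeniusLadderFInjectiveMacaulayficationTauFloorF5YChartAlgebra
import HarnessLib

/-!
# (N1-X) The Rees chart `D(x̄)` of `Bl_τ(P2d4F5)` as an ITERATED MONIC EXTENSION of `k[x, W₀, W₁, W₂]` — tower algebra, chart map, blow-down map
# (crux `FInjectiveMacaulayfication` stmt-ResolutionOfSingularities-15315, chain w45a; res-L1-w45a-plan-1 R18.32 «(N1) ROW #2 TWO-SIDED → stub-3»;
# seat res-L1-w45a-stub-3 g10; twin of `TauFloorF5YChartAlgebra` with one more level)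

[OURS · L1 W4.5a] Support file (`--supports stmt-ResolutionOfSingularities-15315 --as helper`); replaces the role of NO printed item; NOT a statement of
any manuscript; def-free (tower polynomials as hypotheses `g₁ … g₄`); UNCONDITIONAL; characteristic-free. AI-written (AI review is weaker than expert review).

SETTING. `A₀ = k[X0..X4]/(f)`, `f = X4² + X0²X4 + X1⁵ + X2⁵ + X3⁵` (P2d4F5), `τ = (x̄, ȳ², ū², t̄², z̄)`. The chart `D(x̄)` of `Bl_τ X` has ring
`A₀[τ/x̄] = A₀[y²/x, u²/x, t²/x, z/x]` (res-L1-w45a-idea-1 `tau-P2d4F5-floor1.json`: 8 variables, codim-4 CI `y² = xW₀`, `u² = xW₁`, `t² = xW₂`,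
`W₄² + xW₄ + yW₀² + uW₁² + tW₂² = 0`). We type it as the TOWER `T₄ = B₀[y][u][t][W₄]`, `B₀ = k[x,W₀,W₁,W₂] = MvPolynomial (Fin 4) k` (`X 0 = x`, `X 1 = W₀`,
`X 2 = W₁`, `X 3 = W₂`): `g₁ = Y² − xW₀`, `g₂ = U² − xW₁`, `g₃ = T² − xW₂`, `g₄ = W² + x·W + (W₀²y + W₁²u + W₂²t)`, each MONIC — so `T₄` is FREE of rank 16 and
FINITE over `B₀`.
* §1 the tower: monicity, `free_finite_tower`, the four relations in `T₄`; §2 `tower_ringHom_ext`; §3a abstract identities;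
* §3 ★ `exists_chartMap` — `φ : T₄ →+* A₀[1/x̄]`, `x,W₀,W₁,W₂,y,u,t,W₄ ↦ x̄, ȳ²/x̄, ū²/x̄, t̄²/x̄, ȳ, ū, t̄, z̄/x̄` (`g₄ ↦ x̄⁻²f = 0`);
* §4 ★ `exists_blowdownMap` — `ψ₁ : A₀ →+* T₄`, `X0..X4 ↦ x, y, u, t, xW₄` (`f ↦ x²·g₄ + y(y²+xW₀)g₁ + u(u²+xW₁)g₂ + t(t²+xW₂)g₃ = 0`).
[cite: GortzWedhorn2020, (13.19) p. 415] [cite: StacksProject, Tag 0804]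
-/

-- single-problem summit: the doubled namespace component is forced
set_option linter.dupNamespace false

noncomputable section

namespace Summit.ResolutionOfSingularities.ResolutionOfSingularities.Theorems.FInjectiveMacaulayfication.TauFloorF5XChartAlgebra

open MvPolynomial IsLocalization
open Summit.ResolutionOfSingularities.ResolutionOfSingularities.Theorems.FInjectiveMacaulayfication
open TauFloorF5YChartAlgebra

variable (k : Type) [Field k]

/-! ## §1 The tower `T₄ = k[x,W₀,W₁,W₂][y][u][t][W₄]` -/

/-- `X² − C c` is monic (any coefficient ring). [plumbing] -/
theorem monic_sq_sub {R : Type} [CommRing R] (c : R) (g : Polynomial R) (hg : g = Polynomial.X ^ 2 - Polynomial.C c) : g.Monic := by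
  rw [hg]; exact Polynomial.monic_X_pow_sub_C _ two_ne_zero

/-- `X² + (C a · X + C b)` is monic (any coefficient ring). [plumbing] -/
theorem monic_sq_add {R : Type} [CommRing R] (a b : R) (g : Polynomial R) (hg : g = Polynomial.X ^ 2 + (Polynomial.C a * Polynomial.X + Polynomial.C b)) :
    g.Monic := by
  rw [hg]
  nontriviality R
  refine Polynomial.monic_X_pow_add ((Polynomial.degree_add_le _ _).trans_lt ?_)
  exact max_lt ((Polynomial.degree_C_mul_X_le _).trans_lt (by exact_mod_cast Nat.lt_succ_self 1))
    ((Polynomial.degree_C_le).trans_lt (by exact_mod_cast Nat.succ_pos 1))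

/-- A monic `AdjoinRoot` step is free and finite. [Mathlib `AdjoinRoot.powerBasis'`] -/
theorem free_finite_step {R : Type} [CommRing R] (g : Polynomial R) (hg : g.Monic) : Module.Free R (AdjoinRoot g) ∧ Module.Finite R (AdjoinRoot g) :=
  ⟨Module.Free.of_basis (AdjoinRoot.powerBasis' hg).basis, (AdjoinRoot.powerBasis' hg).finite⟩

/-- ★ **`T₄` is FREE and FINITE over `B₀ = k[x,W₀,W₁,W₂]`** (four monic steps, transitivity). [folklore] -/
theorem free_finite_tower (g₁ : Polynomial (MvPolynomial (Fin 4) k)) (hg₁ : g₁ = Polynomial.X ^ 2 - Polynomial.C (X 0 * X 1))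
    (g₂ : Polynomial (AdjoinRoot g₁)) (hg₂ : g₂ = Polynomial.X ^ 2 - Polynomial.C (algebraMap (MvPolynomial (Fin 4) k) (AdjoinRoot g₁) (X 0 * X 2)))
    (g₃ : Polynomial (AdjoinRoot g₂)) (hg₃ : g₃ = Polynomial.X ^ 2 - Polynomial.C (algebraMap (MvPolynomial (Fin 4) k) (AdjoinRoot g₂) (X 0 * X 3)))
    (g₄ : Polynomial (AdjoinRoot g₃))
    (hg₄ : g₄ = Polynomial.X ^ 2 + (Polynomial.C (algebraMap (MvPolynomial (Fin 4) k) (AdjoinRoot g₃) (X 0)) * Polynomial.X +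
      Polynomial.C (algebraMap (MvPolynomial (Fin 4) k) (AdjoinRoot g₃) (X 1 ^ 2) * algebraMap (AdjoinRoot g₁) (AdjoinRoot g₃) (AdjoinRoot.root g₁) +
        algebraMap (MvPolynomial (Fin 4) k) (AdjoinRoot g₃) (X 2 ^ 2) * AdjoinRoot.of g₃ (AdjoinRoot.root g₂) +
        algebraMap (MvPolynomial (Fin 4) k) (AdjoinRoot g₃) (X 3 ^ 2) * AdjoinRoot.root g₃))) :
    Module.Free (MvPolynomial (Fin 4) k) (AdjoinRoot g₄) ∧ Module.Finite (MvPolynomial (Fin 4) k) (AdjoinRoot g₄) := by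
  obtain ⟨hf₁, hfi₁⟩ := free_finite_step g₁ (monic_sq_sub _ g₁ hg₁)
  obtain ⟨hf₂, hfi₂⟩ := free_finite_step g₂ (monic_sq_sub _ g₂ hg₂)
  obtain ⟨hf₃, hfi₃⟩ := free_finite_step g₃ (monic_sq_sub _ g₃ hg₃)
  obtain ⟨hf₄, hfi₄⟩ := free_finite_step g₄ (monic_sq_add _ _ g₄ hg₄)
  haveI : Module.Free (MvPolynomial (Fin 4) k) (AdjoinRoot g₂) := Module.Free.trans (S := AdjoinRoot g₁)
  haveI : Module.Finite (MvPolynomial (Fin 4) k) (AdjoinRoot g₂) := Module.Finite.trans (AdjoinRoot g₁) (AdjoinRoot g₂)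
  haveI : Module.Free (MvPolynomial (Fin 4) k) (AdjoinRoot g₃) := Module.Free.trans (S := AdjoinRoot g₂)
  haveI : Module.Finite (MvPolynomial (Fin 4) k) (AdjoinRoot g₃) := Module.Finite.trans (AdjoinRoot g₂) (AdjoinRoot g₃)
  exact ⟨Module.Free.trans (S := AdjoinRoot g₃), Module.Finite.trans (AdjoinRoot g₃) (AdjoinRoot g₄)⟩

/-- The relation `r² = c` for a root of `X² − C c`. [plumbing] -/
theorem root_sq_of_eq {R : Type} [CommRing R] (c : R) (g : Polynomial R) (hg : g = Polynomial.X ^ 2 - Polynomial.C c) :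
    AdjoinRoot.root g ^ 2 = AdjoinRoot.of g c := by
  subst hg
  have h := AdjoinRoot.eval₂_root (Polynomial.X ^ 2 - Polynomial.C c)
  rw [Polynomial.eval₂_sub, Polynomial.eval₂_X_pow, Polynomial.eval₂_C, sub_eq_zero] at h
  exact h

/-- The relation `r² + a·r + b = 0` for a root of `X² + (C a·X + C b)`. [plumbing] -/
theorem root_rel_of_eq {R : Type} [CommRing R] (a b : R) (g : Polynomial R) (hg : g = Polynomial.X ^ 2 + (Polynomial.C a * Polynomial.X + Polynomial.C b)) :
    AdjoinRoot.root g ^ 2 + AdjoinRoot.of g a * AdjoinRoot.root g + AdjoinRoot.of g b = 0 := by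
  subst hg
  have h := AdjoinRoot.eval₂_root (Polynomial.X ^ 2 + (Polynomial.C a * Polynomial.X + Polynomial.C b))
  simp only [Polynomial.eval₂_add, Polynomial.eval₂_mul, Polynomial.eval₂_X_pow, Polynomial.eval₂_C, Polynomial.eval₂_X] at h
  linear_combination h

/-! ## §2 Ring maps out of the tower are determined by `B₀`, `y`, `u`, `t`, `W₄` -/

/-- ★ **Extensionality out of `T₄`**: two ring maps `T₄ → S` agreeing on `k`, on `x,W₀,W₁,W₂`, on `y`, `u`, `t` and `W₄` are equal. [folklore] -/
theorem tower_ringHom_ext {S : Type} [CommRing S] (g₁ : Polynomial (MvPolynomial (Fin 4) k)) (g₂ : Polynomial (AdjoinRoot g₁))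
    (g₃ : Polynomial (AdjoinRoot g₂)) (g₄ : Polynomial (AdjoinRoot g₃)) {φ ψ : AdjoinRoot g₄ →+* S}
    (hC : ∀ a : k, φ (algebraMap (MvPolynomial (Fin 4) k) (AdjoinRoot g₄) (C a)) = ψ (algebraMap (MvPolynomial (Fin 4) k) (AdjoinRoot g₄) (C a)))
    (hX : ∀ i : Fin 4, φ (algebraMap (MvPolynomial (Fin 4) k) (AdjoinRoot g₄) (X i)) = ψ (algebraMap (MvPolynomial (Fin 4) k) (AdjoinRoot g₄) (X i)))
    (hy : φ (algebraMap (AdjoinRoot g₁) (AdjoinRoot g₄) (AdjoinRoot.root g₁)) = ψ (algebraMap (AdjoinRoot g₁) (AdjoinRoot g₄) (AdjoinRoot.root g₁)))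
    (hu : φ (algebraMap (AdjoinRoot g₂) (AdjoinRoot g₄) (AdjoinRoot.root g₂)) = ψ (algebraMap (AdjoinRoot g₂) (AdjoinRoot g₄) (AdjoinRoot.root g₂)))
    (ht : φ (AdjoinRoot.of g₄ (AdjoinRoot.root g₃)) = ψ (AdjoinRoot.of g₄ (AdjoinRoot.root g₃)))
    (hW : φ (AdjoinRoot.root g₄) = ψ (AdjoinRoot.root g₄)) : φ = ψ := by
  -- rewrite every generator through the `of` chain
  have eB : ∀ b : MvPolynomial (Fin 4) k, algebraMap (MvPolynomial (Fin 4) k) (AdjoinRoot g₄) b =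
      AdjoinRoot.of g₄ (AdjoinRoot.of g₃ (AdjoinRoot.of g₂ (AdjoinRoot.of g₁ b))) := fun b => by
    rw [IsScalarTower.algebraMap_apply (MvPolynomial (Fin 4) k) (AdjoinRoot g₃) (AdjoinRoot g₄),
      IsScalarTower.algebraMap_apply (MvPolynomial (Fin 4) k) (AdjoinRoot g₂) (AdjoinRoot g₃),
      IsScalarTower.algebraMap_apply (MvPolynomial (Fin 4) k) (AdjoinRoot g₁) (AdjoinRoot g₂),
      AdjoinRoot.algebraMap_eq, AdjoinRoot.algebraMap_eq, AdjoinRoot.algebraMap_eq, AdjoinRoot.algebraMap_eq]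
  have ey : algebraMap (AdjoinRoot g₁) (AdjoinRoot g₄) (AdjoinRoot.root g₁) = AdjoinRoot.of g₄ (AdjoinRoot.of g₃ (AdjoinRoot.of g₂ (AdjoinRoot.root g₁))) := by
    rw [IsScalarTower.algebraMap_apply (AdjoinRoot g₁) (AdjoinRoot g₃) (AdjoinRoot g₄), IsScalarTower.algebraMap_apply (AdjoinRoot g₁) (AdjoinRoot g₂) (AdjoinRoot g₃),
      AdjoinRoot.algebraMap_eq, AdjoinRoot.algebraMap_eq, AdjoinRoot.algebraMap_eq]
  have eu : algebraMap (AdjoinRoot g₂) (AdjoinRoot g₄) (AdjoinRoot.root g₂) = AdjoinRoot.of g₄ (AdjoinRoot.of g₃ (AdjoinRoot.root g₂)) := by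
    rw [IsScalarTower.algebraMap_apply (AdjoinRoot g₂) (AdjoinRoot g₃) (AdjoinRoot g₄), AdjoinRoot.algebraMap_eq, AdjoinRoot.algebraMap_eq]
  refine adjoinRoot_ringHom_ext (fun r₃ => ?_) hW
  have h3 : φ.comp (AdjoinRoot.of g₄) = ψ.comp (AdjoinRoot.of g₄) := by
    refine adjoinRoot_ringHom_ext (fun r₂ => ?_) ht
    have h2 : (φ.comp (AdjoinRoot.of g₄)).comp (AdjoinRoot.of g₃) = (ψ.comp (AdjoinRoot.of g₄)).comp (AdjoinRoot.of g₃) := by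
      refine adjoinRoot_ringHom_ext (fun r₁ => ?_) (by simpa only [RingHom.comp_apply, eu] using hu)
      have h1 : ((φ.comp (AdjoinRoot.of g₄)).comp (AdjoinRoot.of g₃)).comp (AdjoinRoot.of g₂) =
          ((ψ.comp (AdjoinRoot.of g₄)).comp (AdjoinRoot.of g₃)).comp (AdjoinRoot.of g₂) := by
        refine adjoinRoot_ringHom_ext (fun b => ?_) (by simpa only [RingHom.comp_apply, ey] using hy)
        have h0 : (((φ.comp (AdjoinRoot.of g₄)).comp (AdjoinRoot.of g₃)).comp (AdjoinRoot.of g₂)).comp (AdjoinRoot.of g₁) =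
            (((ψ.comp (AdjoinRoot.of g₄)).comp (AdjoinRoot.of g₃)).comp (AdjoinRoot.of g₂)).comp (AdjoinRoot.of g₁) := by
          refine MvPolynomial.ringHom_ext (fun a => ?_) (fun i => ?_)
          · simpa only [RingHom.comp_apply, eB] using hC a
          · simpa only [RingHom.comp_apply, eB] using hX i
        exact RingHom.congr_fun h0 b
      exact RingHom.congr_fun h1 r₁
    exact RingHom.congr_fun h2 r₂
  exact RingHom.congr_fun h3 r₃

/-! ## §3a Abstract ring identities (atoms generalized) -/

/-- `r² − x·(r²·i) = 0` when `x·i = 1`. [ring identity] -/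
theorem ident_sq' {L : Type} [CommRing L] (x r i : L) (hxi : x * i = 1) : r ^ 2 - x * (r ^ 2 * i) = 0 := by
  linear_combination (-(r ^ 2)) * hxi

/-- `g₄(z·i) = i²·f` when `x·i = 1`: `(zi)² + (x(zi) + ((y²i)²y + (u²i)²u + (t²i)²t)) = 0`. [ring identity] -/
theorem ident_g₄ {L : Type} [CommRing L] (x y z u t i : L) (hF : z ^ 2 + x ^ 2 * z + y ^ 5 + u ^ 5 + t ^ 5 = 0) (hxi : x * i = 1) :
    (z * i) ^ 2 + (x * (z * i) + ((y ^ 2 * i) ^ 2 * y + (u ^ 2 * i) ^ 2 * u + (t ^ 2 * i) ^ 2 * t)) = 0 := by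
  linear_combination i ^ 2 * hF + (-(x * z * i)) * hxi

/-- `f(x, y, u, t, xW) = x²·g₄ + y(y²+xW₀)·g₁ + u(u²+xW₁)·g₂ + t(t²+xW₂)·g₃`. [ring identity] -/
theorem ident_blowdown' {T : Type} [CommRing T] (x W₀ W₁ W₂ y u t W : T) (R1 : y ^ 2 = x * W₀) (R2 : u ^ 2 = x * W₁) (R3 : t ^ 2 = x * W₂)
    (R4 : W ^ 2 + x * W + (W₀ ^ 2 * y + W₁ ^ 2 * u + W₂ ^ 2 * t) = 0) :
    (x * W) ^ 2 + x ^ 2 * (x * W) + y ^ 5 + u ^ 5 + t ^ 5 = 0 := by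
  linear_combination (x ^ 2) * R4 + (y * (y ^ 2 + x * W₀)) * R1 + (u * (u ^ 2 + x * W₁)) * R2 + (t * (t ^ 2 + x * W₂)) * R3


/-! ## §3 The chart map `φ : T₄ → A₀[1/x̄]` -/

set_option synthInstance.maxHeartbeats 200000 in
set_option maxHeartbeats 800000 in
-- instance search on `Localization.Away` over the quotient ring is slow (as in `TauFloorOneCIChartDomain`)
/-- In `A₀[1/x̄]`: the image of `f` vanishes, expanded. [plumbing] -/
theorem f_rel_away (f : MvPolynomial (Fin 5) k) (hf : f = X 4 ^ 2 + X 0 ^ 2 * X 4 + X 1 ^ 5 + X 2 ^ 5 + X 3 ^ 5) :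
    algebraMap (MvPolynomial (Fin 5) k ⧸ Ideal.span {f}) (Localization.Away (Ideal.Quotient.mk (Ideal.span {f}) (X 0) : MvPolynomial (Fin 5) k ⧸ Ideal.span {f})) (Ideal.Quotient.mk (Ideal.span {f}) (X 4)) ^ 2 +
      algebraMap (MvPolynomial (Fin 5) k ⧸ Ideal.span {f}) (Localization.Away (Ideal.Quotient.mk (Ideal.span {f}) (X 0) : MvPolynomial (Fin 5) k ⧸ Ideal.span {f})) (Ideal.Quotient.mk (Ideal.span {f}) (X 0)) ^ 2 * algebraMap (MvPolynomial (Fin 5) k ⧸ Ideal.span {f}) (Localization.Away (Ideal.Quotient.mk (Ideal.span {f}) (X 0) : MvPolynomial (Fin 5) k ⧸ Ideal.span {f})) (Ideal.Quotient.mk (Ideal.span {f}) (X 4)) +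
      algebraMap (MvPolynomial (Fin 5) k ⧸ Ideal.span {f}) (Localization.Away (Ideal.Quotient.mk (Ideal.span {f}) (X 0) : MvPolynomial (Fin 5) k ⧸ Ideal.span {f})) (Ideal.Quotient.mk (Ideal.span {f}) (X 1)) ^ 5 + algebraMap (MvPolynomial (Fin 5) k ⧸ Ideal.span {f}) (Localization.Away (Ideal.Quotient.mk (Ideal.span {f}) (X 0) : MvPolynomial (Fin 5) k ⧸ Ideal.span {f})) (Ideal.Quotient.mk (Ideal.span {f}) (X 2)) ^ 5 +
      algebraMap (MvPolynomial (Fin 5) k ⧸ Ideal.span {f}) (Localization.Away (Ideal.Quotient.mk (Ideal.span {f}) (X 0) : MvPolynomial (Fin 5) k ⧸ Ideal.span {f})) (Ideal.Quotient.mk (Ideal.span {f}) (X 3)) ^ 5 = 0 := by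
  have h0 : Ideal.Quotient.mk (Ideal.span {f}) (X 4 ^ 2 + X 0 ^ 2 * X 4 + X 1 ^ 5 + X 2 ^ 5 + X 3 ^ 5 : MvPolynomial (Fin 5) k) = 0 := by
    rw [← hf]; exact Ideal.Quotient.eq_zero_iff_mem.mpr (Ideal.mem_span_singleton_self f)
  have h1 := congrArg (algebraMap (MvPolynomial (Fin 5) k ⧸ Ideal.span {f}) (Localization.Away (Ideal.Quotient.mk (Ideal.span {f}) (X 0) : MvPolynomial (Fin 5) k ⧸ Ideal.span {f}))) h0
  rw [map_zero] at h1
  simpa only [map_add, map_mul, map_pow] using h1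

set_option synthInstance.maxHeartbeats 200000 in
set_option maxHeartbeats 1600000 in
-- four `AdjoinRoot.lift`s into `A₀[1/x̄]`, each with one ring identity; instance search on `Localization.Away` over the quotient ring is slow
/-- ★ **The chart map** `φ : T₄ →+* A₀[1/x̄]`: `x ↦ x̄`, `W₀ ↦ ȳ²/x̄`, `W₁ ↦ ū²/x̄`, `W₂ ↦ t̄²/x̄`, `y ↦ ȳ`, `u ↦ ū`, `t ↦ t̄`, `W₄ ↦ z̄/x̄`, constants to constants.
[cite: GortzWedhorn2020, (13.19) p. 415] -/
theorem exists_chartMap (f : MvPolynomial (Fin 5) k) (hf : f = X 4 ^ 2 + X 0 ^ 2 * X 4 + X 1 ^ 5 + X 2 ^ 5 + X 3 ^ 5)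
    (g₁ : Polynomial (MvPolynomial (Fin 4) k)) (hg₁ : g₁ = Polynomial.X ^ 2 - Polynomial.C (X 0 * X 1))
    (g₂ : Polynomial (AdjoinRoot g₁)) (hg₂ : g₂ = Polynomial.X ^ 2 - Polynomial.C (algebraMap (MvPolynomial (Fin 4) k) (AdjoinRoot g₁) (X 0 * X 2)))
    (g₃ : Polynomial (AdjoinRoot g₂)) (hg₃ : g₃ = Polynomial.X ^ 2 - Polynomial.C (algebraMap (MvPolynomial (Fin 4) k) (AdjoinRoot g₂) (X 0 * X 3)))
    (g₄ : Polynomial (AdjoinRoot g₃))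
    (hg₄ : g₄ = Polynomial.X ^ 2 + (Polynomial.C (algebraMap (MvPolynomial (Fin 4) k) (AdjoinRoot g₃) (X 0)) * Polynomial.X +
      Polynomial.C (algebraMap (MvPolynomial (Fin 4) k) (AdjoinRoot g₃) (X 1 ^ 2) * algebraMap (AdjoinRoot g₁) (AdjoinRoot g₃) (AdjoinRoot.root g₁) +
        algebraMap (MvPolynomial (Fin 4) k) (AdjoinRoot g₃) (X 2 ^ 2) * AdjoinRoot.of g₃ (AdjoinRoot.root g₂) +
        algebraMap (MvPolynomial (Fin 4) k) (AdjoinRoot g₃) (X 3 ^ 2) * AdjoinRoot.root g₃))) :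
    ∃ φ : AdjoinRoot g₄ →+* Localization.Away (Ideal.Quotient.mk (Ideal.span {f}) (X 0) : MvPolynomial (Fin 5) k ⧸ Ideal.span {f}),
      (∀ a : k, φ (algebraMap (MvPolynomial (Fin 4) k) (AdjoinRoot g₄) (C a)) = algebraMap (MvPolynomial (Fin 5) k ⧸ Ideal.span {f}) (Localization.Away (Ideal.Quotient.mk (Ideal.span {f}) (X 0) : MvPolynomial (Fin 5) k ⧸ Ideal.span {f})) (Ideal.Quotient.mk (Ideal.span {f}) (C a))) ∧
      (∀ i : Fin 4, φ (algebraMap (MvPolynomial (Fin 4) k) (AdjoinRoot g₄) (X i)) =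
        ![algebraMap (MvPolynomial (Fin 5) k ⧸ Ideal.span {f}) (Localization.Away (Ideal.Quotient.mk (Ideal.span {f}) (X 0) : MvPolynomial (Fin 5) k ⧸ Ideal.span {f})) (Ideal.Quotient.mk (Ideal.span {f}) (X 0)),
          algebraMap (MvPolynomial (Fin 5) k ⧸ Ideal.span {f}) (Localization.Away (Ideal.Quotient.mk (Ideal.span {f}) (X 0) : MvPolynomial (Fin 5) k ⧸ Ideal.span {f})) (Ideal.Quotient.mk (Ideal.span {f}) (X 1)) ^ 2 * Away.invSelf (Ideal.Quotient.mk (Ideal.span {f}) (X 0)),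
          algebraMap (MvPolynomial (Fin 5) k ⧸ Ideal.span {f}) (Localization.Away (Ideal.Quotient.mk (Ideal.span {f}) (X 0) : MvPolynomial (Fin 5) k ⧸ Ideal.span {f})) (Ideal.Quotient.mk (Ideal.span {f}) (X 2)) ^ 2 * Away.invSelf (Ideal.Quotient.mk (Ideal.span {f}) (X 0)),
          algebraMap (MvPolynomial (Fin 5) k ⧸ Ideal.span {f}) (Localization.Away (Ideal.Quotient.mk (Ideal.span {f}) (X 0) : MvPolynomial (Fin 5) k ⧸ Ideal.span {f})) (Ideal.Quotient.mk (Ideal.span {f}) (X 3)) ^ 2 * Away.invSelf (Ideal.Quotient.mk (Ideal.span {f}) (X 0))] i) ∧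
      φ (algebraMap (AdjoinRoot g₁) (AdjoinRoot g₄) (AdjoinRoot.root g₁)) = algebraMap (MvPolynomial (Fin 5) k ⧸ Ideal.span {f}) (Localization.Away (Ideal.Quotient.mk (Ideal.span {f}) (X 0) : MvPolynomial (Fin 5) k ⧸ Ideal.span {f})) (Ideal.Quotient.mk (Ideal.span {f}) (X 1)) ∧
      φ (algebraMap (AdjoinRoot g₂) (AdjoinRoot g₄) (AdjoinRoot.root g₂)) = algebraMap (MvPolynomial (Fin 5) k ⧸ Ideal.span {f}) (Localization.Away (Ideal.Quotient.mk (Ideal.span {f}) (X 0) : MvPolynomial (Fin 5) k ⧸ Ideal.span {f})) (Ideal.Quotient.mk (Ideal.span {f}) (X 2)) ∧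
      φ (AdjoinRoot.of g₄ (AdjoinRoot.root g₃)) = algebraMap (MvPolynomial (Fin 5) k ⧸ Ideal.span {f}) (Localization.Away (Ideal.Quotient.mk (Ideal.span {f}) (X 0) : MvPolynomial (Fin 5) k ⧸ Ideal.span {f})) (Ideal.Quotient.mk (Ideal.span {f}) (X 3)) ∧
      φ (AdjoinRoot.root g₄) = algebraMap (MvPolynomial (Fin 5) k ⧸ Ideal.span {f}) (Localization.Away (Ideal.Quotient.mk (Ideal.span {f}) (X 0) : MvPolynomial (Fin 5) k ⧸ Ideal.span {f})) (Ideal.Quotient.mk (Ideal.span {f}) (X 4)) * Away.invSelf (Ideal.Quotient.mk (Ideal.span {f}) (X 0)) := by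
  let mkA : MvPolynomial (Fin 5) k →+* MvPolynomial (Fin 5) k ⧸ Ideal.span {f} := Ideal.Quotient.mk (Ideal.span {f})
  let L := Localization.Away (mkA (X 0))
  let ι : (MvPolynomial (Fin 5) k ⧸ Ideal.span {f}) →+* L := algebraMap _ _
  let inv : L := Away.invSelf (mkA (X 0))
  have hxi : ι (mkA (X 0)) * inv = 1 := Away.mul_invSelf (S := L) (mkA (X 0))
  have hF := f_rel_away k f hf
  let x : L := ι (mkA (X 0))
  let y : L := ι (mkA (X 1))
  let u : L := ι (mkA (X 2))
  let t : L := ι (mkA (X 3))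
  let z : L := ι (mkA (X 4))
  change x * inv = 1 at hxi
  change z ^ 2 + x ^ 2 * z + y ^ 5 + u ^ 5 + t ^ 5 = 0 at hF
  let v : Fin 4 → L := ![x, y ^ 2 * inv, u ^ 2 * inv, t ^ 2 * inv]
  -- level 0
  let φ₀ : MvPolynomial (Fin 4) k →+* L := eval₂Hom (ι.comp (mkA.comp MvPolynomial.C)) v
  have hφ₀X : ∀ i, φ₀ (X i) = v i := fun i => eval₂Hom_X' _ _ i
  have hφ₀0 : φ₀ (X 0) = x := (hφ₀X 0).trans rfl
  have hφ₀1 : φ₀ (X 1) = y ^ 2 * inv := (hφ₀X 1).trans rfl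
  have hφ₀2 : φ₀ (X 2) = u ^ 2 * inv := (hφ₀X 2).trans rfl
  have hφ₀3 : φ₀ (X 3) = t ^ 2 * inv := (hφ₀X 3).trans rfl
  -- level 1: `y`
  have e1 : g₁.eval₂ φ₀ y = 0 := by
    subst hg₁
    rw [Polynomial.eval₂_sub, Polynomial.eval₂_X_pow, Polynomial.eval₂_C, map_mul, hφ₀0, hφ₀1]
    exact ident_sq' x y inv hxi
  let φ₁ : AdjoinRoot g₁ →+* L := AdjoinRoot.lift φ₀ y e1
  have hφ₁of : ∀ b, φ₁ (AdjoinRoot.of g₁ b) = φ₀ b := fun b => AdjoinRoot.lift_of e1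
  have hφ₁root : φ₁ (AdjoinRoot.root g₁) = y := AdjoinRoot.lift_root e1
  -- level 2: `u`
  have e2 : g₂.eval₂ φ₁ u = 0 := by
    subst hg₂
    rw [Polynomial.eval₂_sub, Polynomial.eval₂_X_pow, Polynomial.eval₂_C, AdjoinRoot.algebraMap_eq, hφ₁of, map_mul, hφ₀0, hφ₀2]
    exact ident_sq' x u inv hxi
  let φ₂ : AdjoinRoot g₂ →+* L := AdjoinRoot.lift φ₁ u e2
  have hφ₂of : ∀ b, φ₂ (AdjoinRoot.of g₂ b) = φ₁ b := fun b => AdjoinRoot.lift_of e2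
  have hφ₂root : φ₂ (AdjoinRoot.root g₂) = u := AdjoinRoot.lift_root e2
  have hφ₂B : ∀ b, φ₂ (algebraMap (MvPolynomial (Fin 4) k) (AdjoinRoot g₂) b) = φ₀ b := fun b => by
    rw [IsScalarTower.algebraMap_apply (MvPolynomial (Fin 4) k) (AdjoinRoot g₁) (AdjoinRoot g₂), AdjoinRoot.algebraMap_eq, AdjoinRoot.algebraMap_eq, hφ₂of, hφ₁of]
  -- level 3: `t`
  have e3 : g₃.eval₂ φ₂ t = 0 := by
    subst hg₃
    rw [Polynomial.eval₂_sub, Polynomial.eval₂_X_pow, Polynomial.eval₂_C, hφ₂B, map_mul, hφ₀0, hφ₀3]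
    exact ident_sq' x t inv hxi
  let φ₃ : AdjoinRoot g₃ →+* L := AdjoinRoot.lift φ₂ t e3
  have hφ₃of : ∀ b, φ₃ (AdjoinRoot.of g₃ b) = φ₂ b := fun b => AdjoinRoot.lift_of e3
  have hφ₃root : φ₃ (AdjoinRoot.root g₃) = t := AdjoinRoot.lift_root e3
  have hφ₃B : ∀ b, φ₃ (algebraMap (MvPolynomial (Fin 4) k) (AdjoinRoot g₃) b) = φ₀ b := fun b => by
    rw [IsScalarTower.algebraMap_apply (MvPolynomial (Fin 4) k) (AdjoinRoot g₂) (AdjoinRoot g₃), AdjoinRoot.algebraMap_eq g₃, hφ₃of, hφ₂B]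
  have hφ₃y : φ₃ (algebraMap (AdjoinRoot g₁) (AdjoinRoot g₃) (AdjoinRoot.root g₁)) = y := by
    rw [IsScalarTower.algebraMap_apply (AdjoinRoot g₁) (AdjoinRoot g₂) (AdjoinRoot g₃), AdjoinRoot.algebraMap_eq g₃, AdjoinRoot.algebraMap_eq g₂,
      hφ₃of, hφ₂of, hφ₁root]
  have hφ₃u : φ₃ (AdjoinRoot.of g₃ (AdjoinRoot.root g₂)) = u := by rw [hφ₃of, hφ₂root]
  -- level 4: `W₄ = z/x̄`
  have e4 : g₄.eval₂ φ₃ (z * inv) = 0 := by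
    subst hg₄
    simp only [Polynomial.eval₂_add, Polynomial.eval₂_mul, Polynomial.eval₂_X_pow, Polynomial.eval₂_C, Polynomial.eval₂_X]
    simp only [map_add, map_mul, map_pow, hφ₃B, hφ₃y, hφ₃u, hφ₃root, hφ₀0, hφ₀1, hφ₀2, hφ₀3]
    exact ident_g₄ x y z u t inv hF hxi
  let φ₄ : AdjoinRoot g₄ →+* L := AdjoinRoot.lift φ₃ (z * inv) e4
  have hφ₄of : ∀ b, φ₄ (AdjoinRoot.of g₄ b) = φ₃ b := fun b => AdjoinRoot.lift_of e4
  refine ⟨φ₄, fun a => ?_, fun i => ?_, ?_, ?_, ?_, AdjoinRoot.lift_root e4⟩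
  · rw [IsScalarTower.algebraMap_apply (MvPolynomial (Fin 4) k) (AdjoinRoot g₃) (AdjoinRoot g₄), AdjoinRoot.algebraMap_eq g₄, hφ₄of, hφ₃B]
    exact eval₂Hom_C _ _ a
  · rw [IsScalarTower.algebraMap_apply (MvPolynomial (Fin 4) k) (AdjoinRoot g₃) (AdjoinRoot g₄), AdjoinRoot.algebraMap_eq g₄, hφ₄of, hφ₃B, hφ₀X]
  · rw [IsScalarTower.algebraMap_apply (AdjoinRoot g₁) (AdjoinRoot g₃) (AdjoinRoot g₄), AdjoinRoot.algebraMap_eq g₄, hφ₄of, hφ₃y]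
  · rw [IsScalarTower.algebraMap_apply (AdjoinRoot g₂) (AdjoinRoot g₃) (AdjoinRoot g₄), AdjoinRoot.algebraMap_eq g₄, AdjoinRoot.algebraMap_eq g₃, hφ₄of, hφ₃u]
  · rw [hφ₄of, hφ₃root]

/-! ## §4 The blow-down map `ψ₁ : A₀ → T₄` -/

/-- `f(x, y, u, t, xW₄) = 0` in `T₄` (by `ident_blowdown'` and the four tower relations). [plumbing] -/
theorem blowdown_kills_f (f : MvPolynomial (Fin 5) k) (hf : f = X 4 ^ 2 + X 0 ^ 2 * X 4 + X 1 ^ 5 + X 2 ^ 5 + X 3 ^ 5)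
    (g₁ : Polynomial (MvPolynomial (Fin 4) k)) (hg₁ : g₁ = Polynomial.X ^ 2 - Polynomial.C (X 0 * X 1))
    (g₂ : Polynomial (AdjoinRoot g₁)) (hg₂ : g₂ = Polynomial.X ^ 2 - Polynomial.C (algebraMap (MvPolynomial (Fin 4) k) (AdjoinRoot g₁) (X 0 * X 2)))
    (g₃ : Polynomial (AdjoinRoot g₂)) (hg₃ : g₃ = Polynomial.X ^ 2 - Polynomial.C (algebraMap (MvPolynomial (Fin 4) k) (AdjoinRoot g₂) (X 0 * X 3)))
    (g₄ : Polynomial (AdjoinRoot g₃))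
    (hg₄ : g₄ = Polynomial.X ^ 2 + (Polynomial.C (algebraMap (MvPolynomial (Fin 4) k) (AdjoinRoot g₃) (X 0)) * Polynomial.X +
      Polynomial.C (algebraMap (MvPolynomial (Fin 4) k) (AdjoinRoot g₃) (X 1 ^ 2) * algebraMap (AdjoinRoot g₁) (AdjoinRoot g₃) (AdjoinRoot.root g₁) +
        algebraMap (MvPolynomial (Fin 4) k) (AdjoinRoot g₃) (X 2 ^ 2) * AdjoinRoot.of g₃ (AdjoinRoot.root g₂) +
        algebraMap (MvPolynomial (Fin 4) k) (AdjoinRoot g₃) (X 3 ^ 2) * AdjoinRoot.root g₃))) :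
    eval₂Hom ((algebraMap (MvPolynomial (Fin 4) k) (AdjoinRoot g₄)).comp MvPolynomial.C)
      ![algebraMap (MvPolynomial (Fin 4) k) (AdjoinRoot g₄) (X 0), algebraMap (AdjoinRoot g₁) (AdjoinRoot g₄) (AdjoinRoot.root g₁),
        algebraMap (AdjoinRoot g₂) (AdjoinRoot g₄) (AdjoinRoot.root g₂), AdjoinRoot.of g₄ (AdjoinRoot.root g₃),
        algebraMap (MvPolynomial (Fin 4) k) (AdjoinRoot g₄) (X 0) * AdjoinRoot.root g₄] f = 0 := by
  have R1 : algebraMap (AdjoinRoot g₁) (AdjoinRoot g₄) (AdjoinRoot.root g₁) ^ 2 =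
      algebraMap (MvPolynomial (Fin 4) k) (AdjoinRoot g₄) (X 0) * algebraMap (MvPolynomial (Fin 4) k) (AdjoinRoot g₄) (X 1) := by
    have h := congrArg (algebraMap (AdjoinRoot g₁) (AdjoinRoot g₄)) (root_sq_of_eq _ g₁ hg₁)
    rw [map_pow, ← AdjoinRoot.algebraMap_eq, ← IsScalarTower.algebraMap_apply, map_mul] at h
    exact h
  have R2 : algebraMap (AdjoinRoot g₂) (AdjoinRoot g₄) (AdjoinRoot.root g₂) ^ 2 =
      algebraMap (MvPolynomial (Fin 4) k) (AdjoinRoot g₄) (X 0) * algebraMap (MvPolynomial (Fin 4) k) (AdjoinRoot g₄) (X 2) := by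
    have h := congrArg (algebraMap (AdjoinRoot g₂) (AdjoinRoot g₄)) (root_sq_of_eq _ g₂ hg₂)
    rw [map_pow, ← AdjoinRoot.algebraMap_eq, ← IsScalarTower.algebraMap_apply, ← IsScalarTower.algebraMap_apply, map_mul] at h
    exact h
  have eB : ∀ b : MvPolynomial (Fin 4) k, AdjoinRoot.of g₄ (algebraMap (MvPolynomial (Fin 4) k) (AdjoinRoot g₃) b) =
      algebraMap (MvPolynomial (Fin 4) k) (AdjoinRoot g₄) b := fun b => by
    rw [IsScalarTower.algebraMap_apply (MvPolynomial (Fin 4) k) (AdjoinRoot g₃) (AdjoinRoot g₄), AdjoinRoot.algebraMap_eq g₄]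
  have ey : AdjoinRoot.of g₄ (algebraMap (AdjoinRoot g₁) (AdjoinRoot g₃) (AdjoinRoot.root g₁)) = algebraMap (AdjoinRoot g₁) (AdjoinRoot g₄) (AdjoinRoot.root g₁) := by
    rw [IsScalarTower.algebraMap_apply (AdjoinRoot g₁) (AdjoinRoot g₃) (AdjoinRoot g₄), AdjoinRoot.algebraMap_eq g₄]
  have eu : AdjoinRoot.of g₄ (AdjoinRoot.of g₃ (AdjoinRoot.root g₂)) = algebraMap (AdjoinRoot g₂) (AdjoinRoot g₄) (AdjoinRoot.root g₂) := by
    rw [IsScalarTower.algebraMap_apply (AdjoinRoot g₂) (AdjoinRoot g₃) (AdjoinRoot g₄), AdjoinRoot.algebraMap_eq g₄, AdjoinRoot.algebraMap_eq g₃]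
  have R3 : AdjoinRoot.of g₄ (AdjoinRoot.root g₃) ^ 2 =
      algebraMap (MvPolynomial (Fin 4) k) (AdjoinRoot g₄) (X 0) * algebraMap (MvPolynomial (Fin 4) k) (AdjoinRoot g₄) (X 3) := by
    have h := root_sq_of_eq _ g₃ hg₃
    rw [← AdjoinRoot.algebraMap_eq g₃, ← IsScalarTower.algebraMap_apply] at h
    have h' := congrArg (AdjoinRoot.of g₄) h
    rw [map_pow, eB, map_mul] at h'
    exact h'
  have R4 := root_rel_of_eq _ _ g₄ hg₄
  rw [map_add, map_add, map_mul, map_mul, map_mul, eB, eB, eB, eB, ey, eu, map_pow, map_pow, map_pow] at R4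
  generalize algebraMap (MvPolynomial (Fin 4) k) (AdjoinRoot g₄) (X 0) = x at R1 R2 R3 R4 ⊢
  generalize algebraMap (MvPolynomial (Fin 4) k) (AdjoinRoot g₄) (X 1) = W₀ at R1 R2 R3 R4 ⊢
  generalize algebraMap (MvPolynomial (Fin 4) k) (AdjoinRoot g₄) (X 2) = W₁ at R1 R2 R3 R4 ⊢
  generalize algebraMap (MvPolynomial (Fin 4) k) (AdjoinRoot g₄) (X 3) = W₂ at R1 R2 R3 R4 ⊢
  generalize algebraMap (AdjoinRoot g₁) (AdjoinRoot g₄) (AdjoinRoot.root g₁) = y at R1 R2 R3 R4 ⊢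
  generalize algebraMap (AdjoinRoot g₂) (AdjoinRoot g₄) (AdjoinRoot.root g₂) = u at R1 R2 R3 R4 ⊢
  generalize AdjoinRoot.of g₄ (AdjoinRoot.root g₃) = t at R1 R2 R3 R4 ⊢
  generalize AdjoinRoot.root g₄ = W at R1 R2 R3 R4 ⊢
  rw [hf]
  simp only [map_add, map_mul, map_pow, eval₂Hom_X', Matrix.cons_val_zero, Matrix.cons_val_one, Matrix.cons_val]
  exact ident_blowdown' x W₀ W₁ W₂ y u t W R1 R2 R3 R4


/-- ★ **The blow-down map** `ψ₁ : A₀ →+* T₄`: `X0 ↦ x`, `X1 ↦ y`, `X2 ↦ u`, `X3 ↦ t`, `X4 ↦ x·W₄`, constants to constants (`f ↦ 0` by `blowdown_kills_f`).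
[cite: GortzWedhorn2020, (13.19) p. 415] -/
theorem exists_blowdownMap (f : MvPolynomial (Fin 5) k) (hf : f = X 4 ^ 2 + X 0 ^ 2 * X 4 + X 1 ^ 5 + X 2 ^ 5 + X 3 ^ 5)
    (g₁ : Polynomial (MvPolynomial (Fin 4) k)) (hg₁ : g₁ = Polynomial.X ^ 2 - Polynomial.C (X 0 * X 1))
    (g₂ : Polynomial (AdjoinRoot g₁)) (hg₂ : g₂ = Polynomial.X ^ 2 - Polynomial.C (algebraMap (MvPolynomial (Fin 4) k) (AdjoinRoot g₁) (X 0 * X 2)))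
    (g₃ : Polynomial (AdjoinRoot g₂)) (hg₃ : g₃ = Polynomial.X ^ 2 - Polynomial.C (algebraMap (MvPolynomial (Fin 4) k) (AdjoinRoot g₂) (X 0 * X 3)))
    (g₄ : Polynomial (AdjoinRoot g₃))
    (hg₄ : g₄ = Polynomial.X ^ 2 + (Polynomial.C (algebraMap (MvPolynomial (Fin 4) k) (AdjoinRoot g₃) (X 0)) * Polynomial.X +
      Polynomial.C (algebraMap (MvPolynomial (Fin 4) k) (AdjoinRoot g₃) (X 1 ^ 2) * algebraMap (AdjoinRoot g₁) (AdjoinRoot g₃) (AdjoinRoot.root g₁) +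
        algebraMap (MvPolynomial (Fin 4) k) (AdjoinRoot g₃) (X 2 ^ 2) * AdjoinRoot.of g₃ (AdjoinRoot.root g₂) +
        algebraMap (MvPolynomial (Fin 4) k) (AdjoinRoot g₃) (X 3 ^ 2) * AdjoinRoot.root g₃))) :
    ∃ ψ : (MvPolynomial (Fin 5) k ⧸ Ideal.span {f}) →+* AdjoinRoot g₄,
      (∀ j : Fin 5, ψ (Ideal.Quotient.mk (Ideal.span {f}) (X j)) =
        ![algebraMap (MvPolynomial (Fin 4) k) (AdjoinRoot g₄) (X 0), algebraMap (AdjoinRoot g₁) (AdjoinRoot g₄) (AdjoinRoot.root g₁),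
          algebraMap (AdjoinRoot g₂) (AdjoinRoot g₄) (AdjoinRoot.root g₂), AdjoinRoot.of g₄ (AdjoinRoot.root g₃),
          algebraMap (MvPolynomial (Fin 4) k) (AdjoinRoot g₄) (X 0) * AdjoinRoot.root g₄] j) ∧
      (∀ a : k, ψ (Ideal.Quotient.mk (Ideal.span {f}) (C a)) = algebraMap (MvPolynomial (Fin 4) k) (AdjoinRoot g₄) (C a)) := by
  have hwf := blowdown_kills_f k f hf g₁ hg₁ g₂ hg₂ g₃ hg₃ g₄ hg₄
  refine ⟨Ideal.Quotient.lift (Ideal.span {f}) (eval₂Hom ((algebraMap (MvPolynomial (Fin 4) k) (AdjoinRoot g₄)).comp MvPolynomial.C)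
    ![algebraMap (MvPolynomial (Fin 4) k) (AdjoinRoot g₄) (X 0), algebraMap (AdjoinRoot g₁) (AdjoinRoot g₄) (AdjoinRoot.root g₁),
      algebraMap (AdjoinRoot g₂) (AdjoinRoot g₄) (AdjoinRoot.root g₂), AdjoinRoot.of g₄ (AdjoinRoot.root g₃),
      algebraMap (MvPolynomial (Fin 4) k) (AdjoinRoot g₄) (X 0) * AdjoinRoot.root g₄]) ?_, fun j => ?_, fun a => ?_⟩
  · intro g hg
    obtain ⟨c, rfl⟩ := Ideal.mem_span_singleton.mp hg
    rw [map_mul, hwf, zero_mul]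
  · rw [Ideal.Quotient.lift_mk, eval₂Hom_X']
  · rw [Ideal.Quotient.lift_mk, eval₂Hom_C, RingHom.comp_apply]

end Summit.ResolutionOfSingularities.ResolutionOfSingularities.Theorems.FInjectiveMacaulayfication.TauFloorF5XChartAlgebra

end
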